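import Summits.Ventures.QEC.CircuitDistance.PortK2DataBB144Z
import Summits.Ventures.QEC.CircuitDistance.K2Chunks
import HarnessLib

/-!
# K2(`[[144,12,12]]`) chunk module — COMPUTATIONAL (native_decide; `Lean.ofReduceBool`)

Cell `qec`, CDX, R146/R152 STEP 1 («computational» header; `ofReduceBool` confined to these chunk modules). Checker of record
`K2.K2Data` (qec-cdx-type-1, PortK2Check); data module of record `PortK2DataBB144X/Z` (p669158/9, crit-1 data audit PASS
2026-08-28T21:20Z); chunk glue `K2Chunks` (idea-1 g2). Cube 1, child 2: leaf group 1 of 4.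
Leaf theorems: the K2 DFS accepts below one descendant state of pivot cube 1 (sector Z); sizes are exact DFS visit counts
(eng-1 g2 `k2count.c`), capped so that the gate's native-axiom audit re-verifies every leaf in place. Assemblies re-derive the
child lists in the kernel (`decide`) and end in the literal cube fact `d144Z.cube (Ts144Z.getD 1 []) (72) (lives144Z.getD 1 0) = true`
(the `hcubes` hypothesis of `K2Inst.k2_complete`). Emitted by qec-cdx-eng-1 g2 (`gen2.py`, idea-1's `gen_k2chunks_from_lean.py` lineage).
-/

namespace Summit.Ventures.QEC.CircuitDistance.K2

set_option maxRecDepth 100000 in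
set_option maxHeartbeats 0 in
set_option exponentiation.threshold 1024 in
/-- K2(144) chunk fact `cube144Z1_ch2_0` (580281 DFS visits; see the module docstring). -/
theorem cube144Z1_ch2_0 : app5 (d144Z.dfs (Ts144Z.getD 1 []) 6) (577588885593260032, 0, 89202981458736490458605531908979845809307648, 3, 2348542582773833227889480596789337027375682548908319870707290971443006043655871952847928387559404194865610752) = true := by native_decide

set_option maxRecDepth 100000 in
set_option maxHeartbeats 0 in
set_option exponentiation.threshold 1024 in
/-- K2(144) chunk fact `cube144Z1_ch2_1` (596520 DFS visits; see the module docstring). -/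
theorem cube144Z1_ch2_1 : app5 (d144Z.dfs (Ts144Z.getD 1 []) 6) (586594126342914048, 0, 89202986111034475705811087072304556790513664, 3, 2348542582773833227889480596789337027375682548908319870707290971443006038338959969708264895944175953744232448) = true := by native_decide

set_option maxRecDepth 100000 in
set_option maxHeartbeats 0 in
set_option exponentiation.threshold 1024 in
/-- K2(144) chunk fact `cube144Z1_ch2_2` (1 DFS visits; see the module docstring). -/
theorem cube144Z1_ch2_2 : app5 (d144Z.dfs (Ts144Z.getD 1 []) 6) (0, 0, 89203321076489413504611058831683747437346816, 3, 2348542582773833227889480596789337027375682548908319870707290971443005698056593048769801432569568521976020992) = true := by decide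

set_option maxRecDepth 100000 in
set_option maxHeartbeats 0 in
set_option exponentiation.threshold 1024 in
/-- K2(144) chunk fact `cube144Z1_ch2_3` (372683 DFS visits; see the module docstring). -/
theorem cube144Z1_ch2_3 : app5 (d144Z.dfs (Ts144Z.getD 1 []) 6) (577588885862227968, 0, 196159429230922976850662541967805723098655683955170213888, 3, 2348542582773833227889480596789337027375682548908319674547861740609231828188173573530225929370960882474942464) = true := by native_decide

set_option maxRecDepth 100000 in
set_option maxHeartbeats 0 in
set_option exponentiation.threshold 1024 in
/-- K2(144) chunk fact `cube144Z1_ch2_4` (359916 DFS visits; see the module docstring). -/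
theorem cube144Z1_ch2_4 : app5 (d144Z.dfs (Ts144Z.getD 1 []) 6) (586594128763027456, 0, 100433627766186981424353424893815228805233144187740221341696, 3, 2348542582773833227889480596789337027375682548908219240920095553717010455557402250867568291683849457922736128) = true := by native_decide
end Summit.Ventures.QEC.CircuitDistance.K2
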